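import Literature.Algebra.Homology.ExtOfProjectiveResolution
import Literature.Algebra.Homology.ExtOfAcyclicResolutionFunctoriality
import HarnessLib

/-!
# Naturality in `Y` of `Extⁿ(X, Y) ≃+ Hⁿ(Ext⁰(P•, Y))` (exact `Ext(–, Y)`-acyclic chain resolution
# `P• → X` of the first variable)

Topic `Algebra/Homology`; namespace `Literature.Algebra.Homology.LeftResolution`.  Definitions with
bodies and theorems; no named fact, no instance, no `sorry`.  Sequel of `ExtOfProjectiveResolution`
(door-c4 g14: the first-variable engine `extAddEquivHomologyZero/Succ`) using the generic concrete
description of homology maps of complexes of abelian groups from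
`ExtOfAcyclicResolutionFunctoriality` (`AcyclicResolution.kerMapOf`, `kerQuotMapOf`,
`homologyMap_concreteOf`).

For a FIXED augmented chain complex `P• → X` and a morphism `f : Y ⟶ Y'` of coefficients:
* `homComplexMap P f : homComplex P Y ⟶ homComplex P Y'` (post-composition with `f` termwise),
  `homComplexMap_f_apply`, `homComplexMap_id`, `homComplexMap_comp`;
* the constituent naturalities `extAddEquivOfIsoLeft_postcomp`, `shiftAddEquiv_postcomp`,
  `iterShift_zero_apply`, `iterShift_succ_apply`, `iterShift_postcomp`, `iterShift_symm_postcomp`,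
  `extOneQuotientAddEquiv_postcomp`, `opcyclesExtAddEquiv_postcomp` — all instances of the
  associativity `([S] ∘ x) ∘ f = [S] ∘ (x ∘ f)` of Yoneda composition;
* **`extAddEquivHomologySucc_naturality`**, **`extAddEquivHomologyZero_naturality`**:
  `Hⁿ(homComplexMap P f) (E_Y x) = E_{Y'} (x ∘ f)` — the identification is natural in the second
  variable (Weibel §2.4 Ex. 2.4.3 / Thm. 2.7.6: `Ext*(X, –)` computed from a projective resolution of `X`
  is a functor in the second variable).

Consumer (door-c4 g14, crux `stmt-BirchSwinnertonDyer-19295` Route A): naturality in the coefficients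
of `RepExt.extTrivialAddEquivGroupCohomology : Extⁿ_{Rep k G}(k, A) ≃+ Hⁿ(G, A)` (sequel), needed to
transport Mathlib/tree statements about `groupCohomology.map (MonoidHom.id G) f` (directed unions,
Tate–Nakayama maps) to `Abelian.Ext`.

## References
* C. A. Weibel, *An introduction to homological algebra* (1994), §2.4 (Ex. 2.4.3), §2.5, Thm. 2.7.6.
  [Weibel1994]
-/

noncomputable section

universe w v u

namespace Literature.Algebra.Homology

namespace LeftResolution

open CategoryTheory CategoryTheory.Limits CategoryTheory.Abelian AcyclicResolution

variable {C : Type u} [Category.{v} C] [Abelian C] [HasExt.{w} C]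

/-- Unfolding of Mathlib's `Ext.precomp`: `α.precomp Z h x = α.comp x h`. [folklore] -/
private theorem precomp_apply' {X Y : C} (Z : C) {n a b : ℕ} (α : Ext X Y n) (h : n + a = b)
    (x : Ext Y Z a) : α.precomp Z h x = α.comp x h := rfl

/-! ## §1 The cochain map `Hom(P•, Y) ⟶ Hom(P•, Y')` induced by `f : Y ⟶ Y'` -/

section HomComplexMap

variable (P : ChainComplex C ℕ) {Y Y' Y'' : C} (f : Y ⟶ Y') (f' : Y' ⟶ Y'')

/-- **Post-composition with `f : Y ⟶ Y'` as a cochain map `Ext⁰(P•, Y) ⟶ Ext⁰(P•, Y')`.**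
[cite: Weibel1994, §2.7 (Theorem 2.7.6)] -/
def homComplexMap : homComplex P Y ⟶ homComplex P Y' where
  f n := AddCommGrpCat.ofHom ((Ext.mk₀ f).postcomp (P.X n) (add_zero 0))
  comm' i j hij := by
    obtain rfl : i + 1 = j := hij
    ext x
    change ((homComplex P Y').d i (i + 1)).hom (x.comp (Ext.mk₀ f) (add_zero 0)) =
      (((homComplex P Y).d i (i + 1)).hom x).comp (Ext.mk₀ f) (add_zero 0)
    rw [homComplex_d_apply, homComplex_d_apply, Ext.comp_assoc_of_third_deg_zero]

/-- Components of `homComplexMap`: `x ↦ x ∘ f`. [cite: Weibel1994, §2.7 (Theorem 2.7.6)] -/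
@[simp]
theorem homComplexMap_f_apply (n : ℕ) (x : Ext (P.X n) Y 0) :
    ((homComplexMap P f).f n).hom x = x.comp (Ext.mk₀ f) (add_zero 0) := rfl

/-- `homComplexMap` of the identity. [cite: Weibel1994, §2.7 (Theorem 2.7.6)] -/
theorem homComplexMap_id (Y : C) : homComplexMap P (𝟙 Y) = 𝟙 (homComplex P Y) := by
  ext n x
  rw [homComplexMap_f_apply, Ext.comp_mk₀_id]
  rfl

/-- `homComplexMap` is functorial. [cite: Weibel1994, §2.7 (Theorem 2.7.6)] -/
theorem homComplexMap_comp :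
    homComplexMap P (f ≫ f') = homComplexMap P f ≫ homComplexMap P f' := by
  ext n x
  change x.comp (Ext.mk₀ (f ≫ f')) (add_zero 0) =
    (x.comp (Ext.mk₀ f) (add_zero 0)).comp (Ext.mk₀ f') (add_zero 0)
  rw [← Ext.mk₀_comp_mk₀, Ext.comp_assoc_of_third_deg_zero]

end HomComplexMap

/-! ## §2 The constituents commute with post-composition -/

section Constituents

variable {Y Y' : C} (f : Y ⟶ Y')

/-- Transport along `X ≅ X'` commutes with post-composition. [cite: Weibel1994, §2.4 (Exercise 2.4.3)] -/
theorem extAddEquivOfIsoLeft_postcomp {X X' : C} (e : X ≅ X') (n : ℕ) (x : Ext X Y n) :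
    extAddEquivOfIsoLeft e Y' n (x.comp (Ext.mk₀ f) (add_zero n)) =
      (extAddEquivOfIsoLeft e Y n x).comp (Ext.mk₀ f) (add_zero n) := by
  rw [extAddEquivOfIsoLeft_apply, extAddEquivOfIsoLeft_apply, Ext.comp_assoc_of_third_deg_zero]

variable {S : ShortComplex C} (hS : S.ShortExact)

/-- One dimension shift commutes with post-composition. [cite: Weibel1994, §2.4 (Exercise 2.4.3)] -/
theorem shiftAddEquiv_postcomp {a b : ℕ} (h : 1 + a = b) (ha : ∀ e : Ext S.X₂ Y a, e = 0)
    (hb : ∀ e : Ext S.X₂ Y b, e = 0) (ha' : ∀ e : Ext S.X₂ Y' a, e = 0)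
    (hb' : ∀ e : Ext S.X₂ Y' b, e = 0) (x : Ext S.X₁ Y a) :
    shiftAddEquiv Y' hS h ha' hb' (x.comp (Ext.mk₀ f) (add_zero a)) =
      (shiftAddEquiv Y hS h ha hb x).comp (Ext.mk₀ f) (add_zero b) := by
  rw [shiftAddEquiv_apply, shiftAddEquiv_apply, Ext.comp_assoc_of_third_deg_zero]

/-- The bottom quotient commutes with post-composition: the class of `x` goes to the class of `x ∘ f`.
[cite: Weibel1994, §2.4 (Exercise 2.4.3)] -/
theorem extOneQuotientAddEquiv_postcomp (h1 : ∀ e : Ext S.X₂ Y 1, e = 0)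
    (h1' : ∀ e : Ext S.X₂ Y' 1, e = 0) (x : Ext S.X₃ Y 1) :
    QuotientAddGroup.map _ _ ((Ext.mk₀ f).postcomp S.X₁ (add_zero 0))
        (fun y hy => by
          obtain ⟨z, rfl⟩ := hy
          refine ⟨z.comp (Ext.mk₀ f) (add_zero 0), ?_⟩
          change (Ext.mk₀ S.f).comp (z.comp (Ext.mk₀ f) (add_zero 0)) (zero_add 0) =
            ((Ext.mk₀ S.f).comp z (zero_add 0)).comp (Ext.mk₀ f) (add_zero 0)
          rw [Ext.comp_assoc_of_third_deg_zero])
        (extOneQuotientAddEquiv Y hS h1 x) =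
      extOneQuotientAddEquiv Y' hS h1' (x.comp (Ext.mk₀ f) (add_zero 1)) := by
  obtain ⟨y, rfl⟩ := extClass_precomp_surjective Y hS (add_zero 1) h1 x
  have e₁ : extOneQuotientAddEquiv Y hS h1 (hS.extClass.precomp Y (add_zero 1) y) =
      QuotientAddGroup.mk y :=
    (AddEquiv.apply_eq_iff_symm_apply _).2 (extOneQuotientAddEquiv_symm_mk Y hS h1 y).symm
  have e₂ : (hS.extClass.precomp Y (add_zero 1) y).comp (Ext.mk₀ f) (add_zero 1) =
      hS.extClass.precomp Y' (add_zero 1) (y.comp (Ext.mk₀ f) (add_zero 0)) := by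
    rw [precomp_apply', precomp_apply', Ext.comp_assoc_of_third_deg_zero]
  have e₃ : extOneQuotientAddEquiv Y' hS h1'
      (hS.extClass.precomp Y' (add_zero 1) (y.comp (Ext.mk₀ f) (add_zero 0))) =
      QuotientAddGroup.mk (y.comp (Ext.mk₀ f) (add_zero 0)) :=
    (AddEquiv.apply_eq_iff_symm_apply _).2 (extOneQuotientAddEquiv_symm_mk Y' hS h1' _).symm
  rw [e₁, e₂, e₃]
  rfl

variable (P : ChainComplex C ℕ)

/-- Unfolding `iterShift` at `n = 0`. [cite: Weibel1994, §2.4 (Exercise 2.4.3)] -/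
theorem iterShift_zero_apply (hP : ∀ n, P.ExactAt (n + 1))
    (hY : ∀ n q (e : Ext (P.X n) Y (q + 1)), e = 0) {a : ℕ} (x : Ext (P.opcycles 0) Y (a + 1)) :
    iterShift P Y hP hY 0 (rfl : a + 1 + 0 = a + 1) x = x := rfl

/-- Unfolding `iterShift` at `n + 1`. [cite: Weibel1994, §2.4 (Exercise 2.4.3)] -/
theorem iterShift_succ_apply (hP : ∀ n, P.ExactAt (n + 1))
    (hY : ∀ n q (e : Ext (P.X n) Y (q + 1)), e = 0) (n : ℕ) {a b : ℕ} (h : a + 1 + (n + 1) = b)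
    (x : Ext (P.opcycles (n + 1)) Y (a + 1)) :
    iterShift P Y hP hY (n + 1) h x =
      iterShift P Y hP hY n (a := a + 1) (by omega)
        (shiftAddEquiv Y (opcyclesSC_shortExact P n (hP n)) (by omega : 1 + (a + 1) = a + 1 + 1)
          (hY n a) (hY n (a + 1)) x) := rfl

/-- **The iterated shift commutes with post-composition.** [cite: Weibel1994, §2.4 (Exercise 2.4.3)] -/
theorem iterShift_postcomp (hP : ∀ n, P.ExactAt (n + 1))
    (hY : ∀ n q (e : Ext (P.X n) Y (q + 1)), e = 0) (hY' : ∀ n q (e : Ext (P.X n) Y' (q + 1)), e = 0) :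
    ∀ (n : ℕ) {a b : ℕ} (h : a + 1 + n = b) (x : Ext (P.opcycles n) Y (a + 1)),
      iterShift P Y' hP hY' n h (x.comp (Ext.mk₀ f) (add_zero _)) =
        (iterShift P Y hP hY n h x).comp (Ext.mk₀ f) (add_zero b)
  | 0, a, b, h, x => by
    subst h
    rw [iterShift_zero_apply, iterShift_zero_apply]
  | n + 1, a, b, h, x => by
    rw [iterShift_succ_apply, iterShift_succ_apply, shiftAddEquiv_postcomp f,
      iterShift_postcomp hP hY hY' n]

/-- The inverse iterated shift commutes with post-composition. [cite: Weibel1994, §2.4 (Exercise 2.4.3)] -/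
theorem iterShift_symm_postcomp (hP : ∀ n, P.ExactAt (n + 1))
    (hY : ∀ n q (e : Ext (P.X n) Y (q + 1)), e = 0) (hY' : ∀ n q (e : Ext (P.X n) Y' (q + 1)), e = 0)
    (n : ℕ) {a b : ℕ} (h : a + 1 + n = b) (z : Ext (P.opcycles 0) Y b) :
    (iterShift P Y' hP hY' n h).symm (z.comp (Ext.mk₀ f) (add_zero b)) =
      ((iterShift P Y hP hY n h).symm z).comp (Ext.mk₀ f) (add_zero _) := by
  apply (iterShift P Y' hP hY' n h).injective
  rw [AddEquiv.apply_symm_apply, iterShift_postcomp f P hP hY hY' n h, AddEquiv.apply_symm_apply]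

/-- `opcyclesExtAddEquiv` commutes with post-composition (underlying elements): under it,
post-composition is the kernel map `kerMapOf (homComplexMap P f)`.
[cite: Weibel1994, §2.4 (Exercise 2.4.3)] -/
theorem opcyclesExtAddEquiv_postcomp (i j : ℕ) (x : Ext (P.opcycles j) Y 0) :
    (opcyclesExtAddEquiv P Y' i j (x.comp (Ext.mk₀ f) (add_zero 0))).1 =
      (kerMapOf (homComplexMap P f) i j (j + 1) (opcyclesExtAddEquiv P Y i j x)).1 := by
  rw [opcyclesExtAddEquiv_apply_val, kerMapOf_apply_val, opcyclesExtAddEquiv_apply_val,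
    homComplexMap_f_apply, Ext.comp_assoc_of_third_deg_zero]

end Constituents

/-! ## §3 Naturality of the main isomorphisms -/

section Main

variable (P : ChainComplex C ℕ) {Y Y' : C} (f : Y ⟶ Y') {X : C} (ε : P.X 0 ⟶ X)
  (hε : P.d 1 0 ≫ ε = 0) (hex : (ShortComplex.mk (P.d 1 0) ε hε).Exact)
  (hP : ∀ n, P.ExactAt (n + 1)) (hY : ∀ n q (e : Ext (P.X n) Y (q + 1)), e = 0)
  (hY' : ∀ n q (e : Ext (P.X n) Y' (q + 1)), e = 0)

/-- **Naturality of `extAddEquivHomologySucc` in `Y`**: `Hⁿ⁺¹(Hom(P•, f)) (E_Y x) = E_{Y'} (x ∘ f)`.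
[cite: Weibel1994, §2.4 (Exercise 2.4.3), Theorem 2.7.6] -/
theorem extAddEquivHomologySucc_naturality [Epi ε] (n : ℕ) (x : Ext X Y (n + 1)) :
    (HomologicalComplex.homologyMap (homComplexMap P f) (n + 1)).hom
        (extAddEquivHomologySucc P Y ε hε hex hP hY n x) =
      extAddEquivHomologySucc P Y' ε hε hex hP hY' n (x.comp (Ext.mk₀ f) (add_zero _)) := by
  set e5 := ((homComplex P Y).homologyIsoSc' n (n + 1) (n + 1 + 1) (CochainComplex.prev_nat_succ n)
      (CochainComplex.next ℕ (n + 1)) ≪≫ ShortComplex.abHomologyIso _) with he5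
  set e5' := ((homComplex P Y').homologyIsoSc' n (n + 1) (n + 1 + 1) (CochainComplex.prev_nat_succ n)
      (CochainComplex.next ℕ (n + 1)) ≪≫ ShortComplex.abHomologyIso _) with he5'
  apply e5'.addCommGroupIsoToAddEquiv.injective
  have hnat := homologyMap_concreteOf (homComplexMap P f) n (n + 1) (n + 1 + 1)
    (CochainComplex.prev_nat_succ n) (CochainComplex.next ℕ (n + 1))
  have step5 : e5'.addCommGroupIsoToAddEquiv ((HomologicalComplex.homologyMap (homComplexMap P f)
      (n + 1)).hom (extAddEquivHomologySucc P Y ε hε hex hP hY n x)) =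
      kerQuotMapOf (homComplexMap P f) n (n + 1) (n + 1 + 1) (e5.addCommGroupIsoToAddEquiv
        (extAddEquivHomologySucc P Y ε hε hex hP hY n x)) := by
    change (HomologicalComplex.homologyMap (homComplexMap P f) (n + 1) ≫ e5'.hom).hom _ =
      (e5.hom ≫ AddCommGrpCat.ofHom (kerQuotMapOf (homComplexMap P f) n (n + 1) (n + 1 + 1))).hom _
    rw [hnat]
  rw [step5]
  change kerQuotMapOf (homComplexMap P f) n (n + 1) (n + 1 + 1)
      (e5.addCommGroupIsoToAddEquiv (e5.addCommGroupIsoToAddEquiv.symm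
        (QuotientAddGroup.congr _ _ (opcyclesExtAddEquiv P Y n (n + 1))
          (map_opcyclesExtAddEquiv_range P Y n)
          (extOneQuotientAddEquiv Y (opcyclesSC_shortExact P n (hP n)) (hY n 0)
            ((iterShift P Y hP hY n (a := 0) (b := n + 1) (by omega)).symm
              (extAddEquivOfIsoLeft (isoOpcyclesZero P ε hε hex).symm Y (n + 1) x)))))) =
    e5'.addCommGroupIsoToAddEquiv (e5'.addCommGroupIsoToAddEquiv.symm
      (QuotientAddGroup.congr _ _ (opcyclesExtAddEquiv P Y' n (n + 1))
        (map_opcyclesExtAddEquiv_range P Y' n)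
        (extOneQuotientAddEquiv Y' (opcyclesSC_shortExact P n (hP n)) (hY' n 0)
          ((iterShift P Y' hP hY' n (a := 0) (b := n + 1) (by omega)).symm
            (extAddEquivOfIsoLeft (isoOpcyclesZero P ε hε hex).symm Y' (n + 1)
              (x.comp (Ext.mk₀ f) (add_zero _)))))))
  rw [AddEquiv.apply_symm_apply, AddEquiv.apply_symm_apply]
  -- steps 1 + 2: push `f` through the transport and the iterated shift
  have step12 : (iterShift P Y' hP hY' n (a := 0) (b := n + 1) (by omega)).symm
      (extAddEquivOfIsoLeft (isoOpcyclesZero P ε hε hex).symm Y' (n + 1)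
        (x.comp (Ext.mk₀ f) (add_zero _))) =
      ((iterShift P Y hP hY n (a := 0) (b := n + 1) (by omega)).symm
        (extAddEquivOfIsoLeft (isoOpcyclesZero P ε hε hex).symm Y (n + 1) x)).comp
          (Ext.mk₀ f) (add_zero _) := by
    rw [extAddEquivOfIsoLeft_postcomp, iterShift_symm_postcomp f P hP hY hY']
  rw [step12]
  -- step 3: the bottom quotient
  set y := (iterShift P Y hP hY n (a := 0) (b := n + 1) (by omega)).symm
    (extAddEquivOfIsoLeft (isoOpcyclesZero P ε hε hex).symm Y (n + 1) x) with hy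
  rw [← extOneQuotientAddEquiv_postcomp f (opcyclesSC_shortExact P n (hP n)) (hY n 0) (hY' n 0) y]
  -- step 4: the two quotient maps agree on representatives
  obtain ⟨z, hz⟩ := QuotientAddGroup.mk_surjective
    (extOneQuotientAddEquiv Y (opcyclesSC_shortExact P n (hP n)) (hY n 0) y)
  rw [← hz]
  change QuotientAddGroup.mk (kerMapOf (homComplexMap P f) n (n + 1) (n + 1 + 1)
      (opcyclesExtAddEquiv P Y n (n + 1) z)) =
    QuotientAddGroup.mk (opcyclesExtAddEquiv P Y' n (n + 1)
      ((Ext.mk₀ f).postcomp (P.opcycles (n + 1)) (add_zero 0) z))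
  congr 1
  apply Subtype.ext
  exact (opcyclesExtAddEquiv_postcomp f P n (n + 1) z).symm

/-- **Naturality of `extAddEquivHomologyZero` in `Y`.**
[cite: Weibel1994, §2.4 (Exercise 2.4.3), Theorem 2.7.6] -/
theorem extAddEquivHomologyZero_naturality [Epi ε] (x : Ext X Y 0) :
    (HomologicalComplex.homologyMap (homComplexMap P f) 0).hom
        (extAddEquivHomologyZero P Y ε hε hex x) =
      extAddEquivHomologyZero P Y' ε hε hex (x.comp (Ext.mk₀ f) (add_zero _)) := by
  set e5 := ((homComplex P Y).homologyIsoSc' 0 0 1 CochainComplex.prev_nat_zero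
      (CochainComplex.next ℕ 0) ≪≫ ShortComplex.abHomologyIso _) with he5
  set e5' := ((homComplex P Y').homologyIsoSc' 0 0 1 CochainComplex.prev_nat_zero
      (CochainComplex.next ℕ 0) ≪≫ ShortComplex.abHomologyIso _) with he5'
  apply e5'.addCommGroupIsoToAddEquiv.injective
  have hnat := homologyMap_concreteOf (homComplexMap P f) 0 0 1 CochainComplex.prev_nat_zero
    (CochainComplex.next ℕ 0)
  have step5 : e5'.addCommGroupIsoToAddEquiv ((HomologicalComplex.homologyMap (homComplexMap P f) 0).hom
      (extAddEquivHomologyZero P Y ε hε hex x)) =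
      kerQuotMapOf (homComplexMap P f) 0 0 1
        (e5.addCommGroupIsoToAddEquiv (extAddEquivHomologyZero P Y ε hε hex x)) := by
    change (HomologicalComplex.homologyMap (homComplexMap P f) 0 ≫ e5'.hom).hom _ =
      (e5.hom ≫ AddCommGrpCat.ofHom (kerQuotMapOf (homComplexMap P f) 0 0 1)).hom _
    rw [hnat]
  rw [step5]
  change kerQuotMapOf (homComplexMap P f) 0 0 1 (e5.addCommGroupIsoToAddEquiv
      (e5.addCommGroupIsoToAddEquiv.symm
        (QuotientAddGroup.quotientAddEquivOfEq (abToCycles_zero_range_eq_bot P Y).symm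
          (QuotientAddGroup.quotientBot.symm
            (opcyclesExtAddEquiv P Y 0 0
              (extAddEquivOfIsoLeft (isoOpcyclesZero P ε hε hex).symm Y 0 x)))))) =
    e5'.addCommGroupIsoToAddEquiv (e5'.addCommGroupIsoToAddEquiv.symm
      (QuotientAddGroup.quotientAddEquivOfEq (abToCycles_zero_range_eq_bot P Y').symm
        (QuotientAddGroup.quotientBot.symm
          (opcyclesExtAddEquiv P Y' 0 0
            (extAddEquivOfIsoLeft (isoOpcyclesZero P ε hε hex).symm Y' 0
              (x.comp (Ext.mk₀ f) (add_zero _)))))))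
  rw [AddEquiv.apply_symm_apply, AddEquiv.apply_symm_apply, extAddEquivOfIsoLeft_postcomp]
  change QuotientAddGroup.mk (kerMapOf (homComplexMap P f) 0 0 1 (opcyclesExtAddEquiv P Y 0 0
      (extAddEquivOfIsoLeft (isoOpcyclesZero P ε hε hex).symm Y 0 x))) =
    QuotientAddGroup.mk (opcyclesExtAddEquiv P Y' 0 0
      ((extAddEquivOfIsoLeft (isoOpcyclesZero P ε hε hex).symm Y 0 x).comp (Ext.mk₀ f) (add_zero 0)))
  congr 1
  apply Subtype.ext
  exact (opcyclesExtAddEquiv_postcomp f P 0 0 _).symm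

end Main

end LeftResolution

end Literature.Algebra.Homology
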